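/-
Copyright (c) 2026 the pub-hodgecm-mathlib formalisation cell (harness21).  Prover seat hodgecm-mathlib-F0P3-p01 (g31), «(D-RAM) FOUR-FRAME» road of crux H413, line LH4, MS ROAD A,
STAGE B (LH4-p10 (g2) SPEC-StageB v2-B5split §B5 (iii)), brick B5 (iii) «GLUED STABILISER INDEX», FILE 1 of 2: membership and linearisation.  2026-09-04.
-/
import Summits.HodgeConjecture.HodgeConjecture.Theorems.F0P3cDyRamDiagonalTorusDefs       -- ★ DEFS LEAF (LH4-p11): `fixedUnitTorus`, `fixedUnitStabilizer`, `latticeStabilizer`, `diagGLUnits`, `stabiliserWeight`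
import Summits.HodgeConjecture.HodgeConjecture.Theorems.F0P3cDyRamDiagonalHNFStability    -- ★ p855216 (LH4-p10): `mapGL_latt_hnf_eq_iff` (T-stability of a column-HNF lattice)
import HarnessLib

/-!
# Crux `H413`, MS ROAD A, STAGE B brick B5 (iii) «GLUED STABILISER INDEX», FILE 1: the fixed diagonal stabiliser of a glued lattice, by two congruences

Cell `hodgecm-mathlib` (D-0151), FLOOR 0, crux item H413 = `stmt-HodgeConjecture-24833`; lane `--supports stmt-HodgeConjecture-24833 --as helper` (count-neutral).  THEOREMS ONLY
(no `def`, no instance, no notation, no `sorry`).  LH4-p10 (g2) SPEC-StageB v2-B5split §B5 (iii) (`F0/P3c/LH4/LH4-p10/g2/SPEC-StageB.v2-B5split.LH4p10g2.md` a6778cd80cb70dec;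
MEMO v2 §4 «STABILISER»).  FILE 2 (`F0P3cDyRamDiagonalGluedStabiliserIndex`) computes the index `[𝒰 : S_F(M)]` from the description proved here.

THE SETTING.  `K` a valued field (`Valued K ℤᵐ⁰`) with an involution `σ`, `|σ·| = |·|`, `ϖ ≠ 0` with `|ϖ| < 1`; `𝒰 = fixedUnitTorus σ 3 = (𝒪_F^×)³` the `σ`-fixed unit diagonal torus and
`S_F(M) = fixedUnitStabilizer σ M` (★ DEFS LEAF `F0P3cDyRamDiagonalTorusDefs`).  The GLUED frame of the strata `G₁(2ρ, s)` ∕ `H(ρ)` (`s = 0`) of the (S-fin) count: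
`V = (1 0 0; x ϖ^ρ 0; xζ + y″  ϖ^ρζ  ϖ^{2ρ+s})`, `|x| = |ζ| = 1`, `|y″| = |ϖ|^s`, `ρ ≥ 1`, and the dualisability criterion (R) of ★ B5 (i) p855737: `∃ f = σf`,
`|ζσy″ − σx·f| ≤ |ϖ|^{ρ+s}`.

WHAT IS PROVED (MEMO v2 §4 «STABILISER» (1)–(2)).
* §1 valuation lemmas: the corner congruence (c) `|xζ(u₂−u₁) + y″(u₂−u₀)| ≤ |ϖ|^{2ρ+s}` is, given (b) `|u₂−u₁| ≤ |ϖ|^{ρ+s}`, equivalent to the LINEARISED (c′)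
  `|g(u₂−u₁) + (u₂−u₀)| ≤ |ϖ|^{2ρ}` for any `g` with `|xζ − g·y″| ≤ |ϖ|^ρ` (`glued_corner_iff`); with `|g|·|ϖ|^s ≤ 1`, (b) + (c′) imply (a) `|u₁−u₀| ≤ |ϖ|^ρ`
  (`glued_first_of_corner`); `c(a) = 1 + g(1−a)` is a unit for `a ≡ 1 (𝔭^{ρ+s})` and its multiplicativity DEFECT `c(a)c(a′) − c(aa′) = (g + g²)(1−a)(1−a′)` is `|ϖ|^{2ρ}`-small
  (`v_defect_le`) — the twisted map `u ↦ (u₀∕u₂)·c(u₁∕u₂)⁻¹` of FILE 2 is a homomorphism modulo `U_{2ρ}`.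
* §2 `mem_latticeStabilizer_latt_glued_exp_iff`: `diag(u)·latt V = latt V ⟺ (a) ∧ (b) ∧ (c)` (★ `mapGL_latt_hnf_eq_iff` read on the glued frame; any second exponent `s` — the
  case `s = 2t` is ★ p855806 `…GluedStabiliserMembership.mem_latticeStabilizer_latt_glued_iff` (LH4-p08 (g2), full unit torus route of B5 (iv))); `mem_fixedUnitStabilizer_latt_glued_iff`:
  for `u ∈ 𝒰` and any lineariser `g`, `u ∈ S_F(latt V) ⟺ (b) ∧ (c′)`.
* §3 `lineariser_of_criterionR`: (R) supplies `g := ζσζ∕f`, `σ`-fixed, with `|g|·|ϖ|^s = 1` and `|xζ − g y″| ≤ |ϖ|^ρ` (apply `σ` to (R), multiply by `ζ∕f`).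
* §4 `exists_unitLevel_subgroup` (the level groups `U(r) = {|w| = 1, |w−1| ≤ r}` as subgroups of `K^×`, by membership letter — the currency of ★ B1 p855694),
  `mem_map_fixedUnitTorus_iff` (`u ↦ u₁∕u₂` maps `𝒰` ONTO the fixed units `U_F = {σw = w, |w| = 1}`).

HONEST LABEL.  Count-neutral (`--supports`); the census laws (MS) stay PROVER TARGETS until the Stage B assembly B10 lands; `HC_CM` is proved only modulo the 7 printed citations
(2 remaining named inputs: hLiu418 = `stmt-HodgeConjecture-24832`, h413 = `stmt-HodgeConjecture-24833`) until rung 0 closes.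

## References
* [Kottwitz1986BaseChangeUnits] R. E. Kottwitz, *Base change for unit elements of Hecke algebras*, Compositio Math. 60 (1986), §1 pp. 240–241 (orbital integrals of units as weighted
  fixed-lattice counts; the torus stabilisers).
* [Serre1979] J.-P. Serre, *Local Fields*, GTM 67 (1979), Ch. II §3, Ch. IV §2 Prop. 6 (the filtration `U ⊃ U¹ ⊃ U² ⊃ …`).
* [Serre1980Trees] J.-P. Serre, *Trees*, Springer (1980), Ch. II §1.1 (lattices, diagonal action, Hermite normal form).
-/

set_option autoImplicit false

noncomputable section

namespace Summit.HodgeConjecture.HodgeConjecture.Cruxes.H413.F0P3cDyRamDiagonalGluedFixedStabiliser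

open Matrix
open Literature.NumberTheory.Automorphic Literature.NumberTheory.Automorphic.HermitianLattice Literature.NumberTheory.Automorphic.UnitaryGroup
open Literature.NumberTheory.Automorphic.UnitaryLatticeTree
open Summit.HodgeConjecture.HodgeConjecture.Cruxes.H413.F0P3cDyRamDiagonalTorusDefs
open Summit.HodgeConjecture.HodgeConjecture.Cruxes.H413.F0P3cDyRamDiagonalHNFStability
open scoped Valued WithZero Matrix MatrixGroups

variable {K : Type*} [Field K] [Valued K ℤᵐ⁰]


/-! ## §1  Valuation lemmas: linearisation of the corner congruence, the first congruence is implied, the defect of `1 + g(1−a)` -/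

/-- `|a·c⁻¹| ≤ 1 ⟺ |a| ≤ |c|` (`c ≠ 0`). [cite: Serre1979, Ch. II §3] -/
theorem v_mul_inv_le_one_iff {a c : K} (hc : c ≠ 0) : Valued.v (a * c⁻¹) ≤ 1 ↔ Valued.v a ≤ Valued.v c := by
  rw [map_mul, map_inv₀, mul_inv_le_iff₀ ((Valuation.pos_iff _).2 hc), one_mul]

/-- **LINEARISATION OF THE CORNER CONGRUENCE.**  If `|κ − g·y″| ≤ |ϖ|^ρ`, `|y″| = |ϖ|^s` and `|δ₁| ≤ |ϖ|^{ρ+s}`, then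
`|κδ₁ + y″δ₂| ≤ |ϖ|^{2ρ+s} ⟺ |gδ₁ + δ₂| ≤ |ϖ|^{2ρ}` (`κδ₁ + y″δ₂ = y″(gδ₁ + δ₂) + (κ − gy″)δ₁`, the last term being `|ϖ|^{2ρ+s}`-small). (MEMO v2 §4 (c) ⟺ (c′).)
[cite: Kottwitz1986BaseChangeUnits, §1 pp. 240–241] -/
theorem glued_corner_iff {ϖ : K} (hϖ0 : ϖ ≠ 0) (ρ s : ℕ) {κ y'' g δ₁ δ₂ : K} (hy'' : Valued.v y'' = Valued.v ϖ ^ s)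
    (hlin : Valued.v (κ - g * y'') ≤ Valued.v ϖ ^ ρ) (hδ₁ : Valued.v δ₁ ≤ Valued.v ϖ ^ (ρ + s)) :
    Valued.v (κ * δ₁ + y'' * δ₂) ≤ Valued.v ϖ ^ (2 * ρ + s) ↔ Valued.v (g * δ₁ + δ₂) ≤ Valued.v ϖ ^ (2 * ρ) := by

  have hvϖ : 0 < Valued.v ϖ := (Valuation.pos_iff _).2 hϖ0
  have key : κ * δ₁ + y'' * δ₂ = y'' * (g * δ₁ + δ₂) + (κ - g * y'') * δ₁ := by ring
  have hsmall : Valued.v ((κ - g * y'') * δ₁) ≤ Valued.v ϖ ^ (2 * ρ + s) := by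
    rw [map_mul]
    calc Valued.v (κ - g * y'') * Valued.v δ₁ ≤ Valued.v ϖ ^ ρ * Valued.v ϖ ^ (ρ + s) := mul_le_mul' hlin hδ₁
      _ = Valued.v ϖ ^ (2 * ρ + s) := by rw [← pow_add]; congr 1; ring
  have hsplit : Valued.v ϖ ^ (2 * ρ + s) = Valued.v ϖ ^ s * Valued.v ϖ ^ (2 * ρ) := by rw [← pow_add]; congr 1; ring
  rw [key]
  constructor
  · intro h
    have h2 : Valued.v (y'' * (g * δ₁ + δ₂)) ≤ Valued.v ϖ ^ (2 * ρ + s) := by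
      have e : y'' * (g * δ₁ + δ₂) = (y'' * (g * δ₁ + δ₂) + (κ - g * y'') * δ₁) - (κ - g * y'') * δ₁ := by ring
      rw [e]
      exact (Valuation.map_sub _ _ _).trans (max_le h hsmall)
    rw [map_mul, hy'', hsplit] at h2
    exact (mul_le_mul_iff_right₀ (pow_pos hvϖ _)).1 h2
  · intro h
    refine (Valuation.map_add _ _ _).trans (max_le ?_ hsmall)
    rw [map_mul, hy'', hsplit]
    exact mul_le_mul_right h _


/-- **THE FIRST CONGRUENCE IS IMPLIED**: `|g|·|ϖ|^s ≤ 1`, `|δ₁| ≤ |ϖ|^{ρ+s}`, `|gδ₁ + δ₂| ≤ |ϖ|^{2ρ}` ⟹ `|δ₂ − δ₁| ≤ |ϖ|^ρ` (MEMO v2 §4: (b) + (c′) ⟹ (a)).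
[cite: Kottwitz1986BaseChangeUnits, §1 pp. 240–241] -/
theorem glued_first_of_corner {ϖ : K} (hϖ1 : Valued.v ϖ ≤ 1) (ρ s : ℕ) {g δ₁ δ₂ : K} (hg : Valued.v g * Valued.v ϖ ^ s ≤ 1)
    (hδ₁ : Valued.v δ₁ ≤ Valued.v ϖ ^ (ρ + s)) (hc : Valued.v (g * δ₁ + δ₂) ≤ Valued.v ϖ ^ (2 * ρ)) :
    Valued.v (δ₂ - δ₁) ≤ Valued.v ϖ ^ ρ := by

  have e : δ₂ - δ₁ = (g * δ₁ + δ₂) - (g * δ₁ + δ₁) := by ring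
  have hρ2 : Valued.v ϖ ^ (2 * ρ) ≤ Valued.v ϖ ^ ρ := pow_le_pow_right_of_le_one' hϖ1 (by omega)
  have hρs : Valued.v ϖ ^ (ρ + s) ≤ Valued.v ϖ ^ ρ := pow_le_pow_right_of_le_one' hϖ1 (by omega)
  have hgδ : Valued.v (g * δ₁) ≤ Valued.v ϖ ^ ρ := by
    rw [map_mul]
    calc Valued.v g * Valued.v δ₁ ≤ Valued.v g * Valued.v ϖ ^ (ρ + s) := mul_le_mul_right hδ₁ _
      _ = (Valued.v g * Valued.v ϖ ^ s) * Valued.v ϖ ^ ρ := by rw [pow_add, mul_assoc, mul_comm (Valued.v ϖ ^ ρ)]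
      _ ≤ 1 * Valued.v ϖ ^ ρ := mul_le_mul_left hg _
      _ = Valued.v ϖ ^ ρ := one_mul _
  rw [e]
  exact (Valuation.map_sub _ _ _).trans (max_le (hc.trans hρ2) ((Valuation.map_add _ _ _).trans (max_le hgδ (hδ₁.trans hρs))))


/-- `c(a) := 1 + g(1 − a)` is a unit congruent to `1` modulo `𝔭^ρ` when `|g|·|ϖ|^s ≤ 1` and `|a − 1| ≤ |ϖ|^{ρ+s}` (`ρ ≥ 1`, `|ϖ| < 1`).
[cite: Serre1979, Ch. IV §2 Prop. 6] -/
theorem v_one_add_mul_one_sub_eq_one {ϖ : K} (hϖ1 : Valued.v ϖ < 1) {ρ : ℕ} (hρ : 1 ≤ ρ) (s : ℕ) {g a : K}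
    (hg : Valued.v g * Valued.v ϖ ^ s ≤ 1) (ha : Valued.v (a - 1) ≤ Valued.v ϖ ^ (ρ + s)) :
    Valued.v (g * (1 - a)) ≤ Valued.v ϖ ^ ρ ∧ Valued.v (1 + g * (1 - a)) = 1 := by

  have hvϖρ : Valued.v ϖ ^ ρ < 1 := pow_lt_one₀ zero_le hϖ1 (by omega)
  have h1 : Valued.v (g * (1 - a)) ≤ Valued.v ϖ ^ ρ := by
    rw [map_mul, Valuation.map_sub_swap]
    calc Valued.v g * Valued.v (a - 1) ≤ Valued.v g * Valued.v ϖ ^ (ρ + s) := mul_le_mul_right ha _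
      _ = (Valued.v g * Valued.v ϖ ^ s) * Valued.v ϖ ^ ρ := by rw [pow_add, mul_assoc, mul_comm (Valued.v ϖ ^ ρ)]
      _ ≤ 1 * Valued.v ϖ ^ ρ := mul_le_mul_left hg _
      _ = Valued.v ϖ ^ ρ := one_mul _
  exact ⟨h1, Valuation.map_one_add_of_lt _ (h1.trans_lt hvϖρ)⟩


/-- **THE DEFECT OF `c(a) = 1 + g(1−a)`**: `c(a)·c(a′) − c(a·a′) = (g + g²)(1−a)(1−a′)`, so `|c(a)c(a′) − c(aa′)| ≤ |ϖ|^{2ρ}` when `|g|·|ϖ|^s ≤ 1`, `|ϖ| ≤ 1` and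
`|a−1|, |a′−1| ≤ |ϖ|^{ρ+s}` — `u ↦ (u₀∕u₂)·c(u₁∕u₂)⁻¹` is a homomorphism modulo `U_{2ρ}`. [cite: Serre1979, Ch. IV §2 Prop. 6] -/
theorem v_defect_le {ϖ : K} (hϖ1 : Valued.v ϖ ≤ 1) (ρ s : ℕ) {g a a' : K} (hg : Valued.v g * Valued.v ϖ ^ s ≤ 1)
    (ha : Valued.v (a - 1) ≤ Valued.v ϖ ^ (ρ + s)) (ha' : Valued.v (a' - 1) ≤ Valued.v ϖ ^ (ρ + s)) :
    Valued.v ((1 + g * (1 - a)) * (1 + g * (1 - a')) - (1 + g * (1 - a * a'))) ≤ Valued.v ϖ ^ (2 * ρ) := by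

  have e : (1 + g * (1 - a)) * (1 + g * (1 - a')) - (1 + g * (1 - a * a')) = g * (1 - a) * (1 - a') + (g * (1 - a)) * (g * (1 - a')) := by ring
  have hρs : Valued.v ϖ ^ (ρ + s) ≤ Valued.v ϖ ^ ρ := pow_le_pow_right_of_le_one' hϖ1 (by omega)
  have hga : ∀ b : K, Valued.v (b - 1) ≤ Valued.v ϖ ^ (ρ + s) → Valued.v (g * (1 - b)) ≤ Valued.v ϖ ^ ρ := fun b hb => by
    rw [map_mul, Valuation.map_sub_swap]
    calc Valued.v g * Valued.v (b - 1) ≤ Valued.v g * Valued.v ϖ ^ (ρ + s) := mul_le_mul_right hb _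
      _ = (Valued.v g * Valued.v ϖ ^ s) * Valued.v ϖ ^ ρ := by rw [pow_add, mul_assoc, mul_comm (Valued.v ϖ ^ ρ)]
      _ ≤ 1 * Valued.v ϖ ^ ρ := mul_le_mul_left hg _
      _ = Valued.v ϖ ^ ρ := one_mul _
  have h2ρ : Valued.v ϖ ^ (2 * ρ) = Valued.v ϖ ^ ρ * Valued.v ϖ ^ ρ := by rw [← pow_add, two_mul]
  rw [e, h2ρ]
  refine (Valuation.map_add _ _ _).trans (max_le ?_ ?_)
  · rw [map_mul, Valuation.map_sub_swap _ (1 : K) a']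
    exact mul_le_mul' (hga a ha) (ha'.trans hρs)
  · rw [map_mul]
    exact mul_le_mul' (hga a ha) (hga a' ha')


/-! ## §2  Membership in the diagonal stabiliser of the glued frame -/

/-- **`diag(u)·latt V = latt V` ON THE GLUED FRAME ⟺ (a) ∧ (b) ∧ (c)** (any second exponent `s`; the case `s = 2t` is ★ p855806
`F0P3cDyRamDiagonalGluedStabiliserMembership.mem_latticeStabilizer_latt_glued_iff` of LH4-p08 (g2), proved independently there): for units `u`, `V = (1 0 0; x ϖ^ρ 0; xζ+y″ ϖ^ρζ ϖ^{2ρ+s})` with `|x| = |ζ| = 1`: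
(a) `|u₁−u₀| ≤ |ϖ|^ρ`, (b) `|u₂−u₁| ≤ |ϖ|^{ρ+s}`, (c) `|xζ(u₂−u₁) + y″(u₂−u₀)| ≤ |ϖ|^{2ρ+s}` (★ `mapGL_latt_hnf_eq_iff` with `T = diag(u)`, `b = ρ`, `c = 2ρ+s`,
`y = xζ + y″`, `z = ϖ^ρζ`). [cite: Serre1980Trees, II §1.1] [cite: Kottwitz1986BaseChangeUnits, §1 pp. 240–241] -/
theorem mem_latticeStabilizer_latt_glued_exp_iff {ϖ : K} (hϖ0 : ϖ ≠ 0) (ρ s : ℕ) {x ζ y'' : K} (hx : Valued.v x = 1) (hζ : Valued.v ζ = 1)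
    (V : GL (Fin 3) K) (hV : (V : Matrix (Fin 3) (Fin 3) K) = !![1, 0, 0; x, ϖ ^ ρ, 0; x * ζ + y'', ϖ ^ ρ * ζ, ϖ ^ (2 * ρ + s)])
    (u : Fin 3 → Kˣ) (hu : ∀ i, Valued.v (u i : K) = 1) :
    u ∈ latticeStabilizer (latt (V : Matrix (Fin 3) (Fin 3) K)) ↔
      Valued.v ((u 1 : K) - u 0) ≤ Valued.v ϖ ^ ρ ∧ Valued.v ((u 2 : K) - u 1) ≤ Valued.v ϖ ^ (ρ + s) ∧
        Valued.v (x * ζ * ((u 2 : K) - u 1) + y'' * ((u 2 : K) - u 0)) ≤ Valued.v ϖ ^ (2 * ρ + s) := by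

  have hvϖ : 0 < Valued.v ϖ := (Valuation.pos_iff _).2 hϖ0
  have hb : (ϖ ^ ρ : K) ≠ 0 := pow_ne_zero _ hϖ0
  have hc : (ϖ ^ (2 * ρ + s) : K) ≠ 0 := pow_ne_zero _ hϖ0
  rw [mem_latticeStabilizer_iff, mapGL_latt_hnf_eq_iff hϖ0 (fun i => (u i : K)) hu (diagGLUnits u) (coe_diagGLUnits u) V hV]
  refine and_congr ?_ (and_congr ?_ ?_)
  · rw [v_mul_inv_le_one_iff hb, map_mul, hx, mul_one, map_pow]
  · rw [v_mul_inv_le_one_iff hc, map_mul, map_mul, map_pow, hζ, mul_one, map_pow,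
      show Valued.v ϖ ^ (2 * ρ + s) = Valued.v ϖ ^ (ρ + s) * Valued.v ϖ ^ ρ by rw [← pow_add]; congr 1; ring]
    exact mul_le_mul_iff_left₀ (pow_pos hvϖ _)
  · have e3 : ((u 2 : K) - u 0) * (x * ζ + y'') + ((u 0 : K) - u 1) * x * (ϖ ^ ρ * ζ) * (ϖ ^ ρ)⁻¹ =
        x * ζ * ((u 2 : K) - u 1) + y'' * ((u 2 : K) - u 0) := by
      field_simp
      ring
    rw [v_mul_inv_le_one_iff hc, e3, map_pow]


/-- **`S_F(latt V)` ON THE GLUED FRAME ⟺ (b) ∧ (c′)** for `u ∈ 𝒰`: given a LINEARISER `g` (`|g|·|ϖ|^s ≤ 1`, `|xζ − g·y″| ≤ |ϖ|^ρ`; §3 produces it from (R)),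
`u ∈ S_F(latt V) ⟺ |u₂−u₁| ≤ |ϖ|^{ρ+s} ∧ |g(u₂−u₁) + (u₂−u₀)| ≤ |ϖ|^{2ρ}`. [cite: Kottwitz1986BaseChangeUnits, §1 pp. 240–241] -/
theorem mem_fixedUnitStabilizer_latt_glued_iff {σ : K →+* K} {ϖ : K} (hϖ0 : ϖ ≠ 0) (hϖ1 : Valued.v ϖ ≤ 1) (ρ s : ℕ) {x ζ y'' g : K}
    (hx : Valued.v x = 1) (hζ : Valued.v ζ = 1) (hy'' : Valued.v y'' = Valued.v ϖ ^ s) (hg : Valued.v g * Valued.v ϖ ^ s ≤ 1)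
    (hlin : Valued.v (x * ζ - g * y'') ≤ Valued.v ϖ ^ ρ)
    (V : GL (Fin 3) K) (hV : (V : Matrix (Fin 3) (Fin 3) K) = !![1, 0, 0; x, ϖ ^ ρ, 0; x * ζ + y'', ϖ ^ ρ * ζ, ϖ ^ (2 * ρ + s)])
    {u : Fin 3 → Kˣ} (hu : u ∈ fixedUnitTorus σ 3) :
    u ∈ fixedUnitStabilizer σ (latt (V : Matrix (Fin 3) (Fin 3) K)) ↔
      Valued.v ((u 2 : K) - u 1) ≤ Valued.v ϖ ^ (ρ + s) ∧ Valued.v (g * ((u 2 : K) - u 1) + ((u 2 : K) - u 0)) ≤ Valued.v ϖ ^ (2 * ρ) := by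

  obtain ⟨hu1, hu2⟩ := (mem_fixedUnitTorus_iff σ u).1 hu
  rw [mem_fixedUnitStabilizer_iff, ← mem_latticeStabilizer_iff, mem_latticeStabilizer_latt_glued_exp_iff hϖ0 ρ s hx hζ V hV u hu1]
  constructor
  · rintro ⟨⟨-, hb, hc⟩, -, -⟩
    exact ⟨hb, (glued_corner_iff hϖ0 ρ s hy'' hlin hb).1 hc⟩
  · rintro ⟨hb, hc'⟩
    have hc := (glued_corner_iff hϖ0 ρ s hy'' hlin hb).2 hc'
    refine ⟨⟨?_, hb, hc⟩, hu1, hu2⟩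
    have ha := glued_first_of_corner hϖ1 ρ s hg hb hc'
    rwa [show ((u 2 : K) - u 0) - ((u 2 : K) - u 1) = (u 1 : K) - u 0 by ring] at ha


/-! ## §3  The criterion (R) supplies a `σ`-fixed lineariser `g = ζσζ∕f` -/

/-- **(R) ⟹ A FIXED LINEARISER.**  If `f = σf` and `|ζσy″ − σx·f| ≤ |ϖ|^{ρ+s}` (`|x| = |ζ| = 1`, `|y″| = |ϖ|^s`, `ρ ≥ 1`, `|ϖ| < 1`), then `|f| = |ϖ|^s` (so `f ≠ 0`) and
`g := ζσζ·f⁻¹` is `σ`-fixed with `|g|·|ϖ|^s = 1` and `|xζ − g·y″| ≤ |ϖ|^ρ` (apply `σ` to (R) and multiply by `ζ∕f`). (MEMO v2 §4 «LINEARISATION by (R)».)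
[cite: Kottwitz1986BaseChangeUnits, §1 pp. 240–241] -/
theorem lineariser_of_criterionR {σ : K →+* K} (hσ : ∀ a, σ (σ a) = a) (hvσ : ∀ a, Valued.v (σ a) = Valued.v a)
    {ϖ : K} (hϖ0 : ϖ ≠ 0) (hϖ1 : Valued.v ϖ < 1) {ρ : ℕ} (hρ : 1 ≤ ρ) (s : ℕ) {x ζ y'' f : K}
    (hx : Valued.v x = 1) (hζ : Valued.v ζ = 1) (hy'' : Valued.v y'' = Valued.v ϖ ^ s) (hf : σ f = f)
    (hR : Valued.v (ζ * σ y'' - σ x * f) ≤ Valued.v ϖ ^ (ρ + s)) :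
    Valued.v f = Valued.v ϖ ^ s ∧ σ (ζ * σ ζ * f⁻¹) = ζ * σ ζ * f⁻¹ ∧ Valued.v (ζ * σ ζ * f⁻¹) * Valued.v ϖ ^ s = 1 ∧
      Valued.v (x * ζ - ζ * σ ζ * f⁻¹ * y'') ≤ Valued.v ϖ ^ ρ := by

  have hvϖ : 0 < Valued.v ϖ := (Valuation.pos_iff _).2 hϖ0
  have hvϖs : Valued.v ϖ ^ s ≠ 0 := pow_ne_zero _ hvϖ.ne'
  have h1 : Valued.v (ζ * σ y'') = Valued.v ϖ ^ s := by rw [map_mul, hζ, hvσ, hy'', one_mul]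
  have hlt : Valued.v (ζ * σ y'' - σ x * f) < Valued.v (ζ * σ y'') :=
    hR.trans_lt (by rw [h1]; exact pow_lt_pow_right_of_lt_one₀ hvϖ hϖ1 (by omega))
  have hvxf : Valued.v (σ x * f) = Valued.v (ζ * σ y'') := by
    have e : σ x * f = ζ * σ y'' + -(ζ * σ y'' - σ x * f) := by ring
    rw [e]
    exact Valuation.map_add_eq_of_lt_left _ (by rwa [Valuation.map_neg])
  have hvf : Valued.v f = Valued.v ϖ ^ s := by rw [map_mul, hvσ, hx, one_mul] at hvxf; exact hvxf.trans h1
  have hf0 : f ≠ 0 := fun h => by rw [h, map_zero] at hvf; exact hvϖs hvf.symm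
  have hζ0 : ζ ≠ 0 := fun h => by rw [h, map_zero] at hζ; exact zero_ne_one hζ
  refine ⟨hvf, ?_, ?_, ?_⟩
  · rw [map_mul, map_mul, map_inv₀, hσ, hf, mul_comm (σ ζ) ζ]
  · rw [map_mul, map_mul, map_inv₀, hζ, hvσ, hζ, hvf, one_mul, one_mul, inv_mul_cancel₀ hvϖs]
  · have hσR : Valued.v (σ ζ * y'' - x * f) ≤ Valued.v ϖ ^ (ρ + s) := by
      have h := hR
      rw [← hvσ (ζ * σ y'' - σ x * f), map_sub, map_mul, map_mul, hσ, hσ, hf] at h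
      exact h
    have e : x * ζ - ζ * σ ζ * f⁻¹ * y'' = ζ * f⁻¹ * -(σ ζ * y'' - x * f) := by
      field_simp
      ring
    rw [e, map_mul, map_mul, Valuation.map_neg, hζ, one_mul, map_inv₀, hvf]
    calc (Valued.v ϖ ^ s)⁻¹ * Valued.v (σ ζ * y'' - x * f) ≤ (Valued.v ϖ ^ s)⁻¹ * Valued.v ϖ ^ (ρ + s) := mul_le_mul_right hσR _
      _ = Valued.v ϖ ^ ρ := by rw [pow_add, mul_comm (Valued.v ϖ ^ ρ), ← mul_assoc, inv_mul_cancel₀ hvϖs, one_mul]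


/-! ## §4  Level subgroups of `K^×` by membership letter; the coordinate-ratio map `𝒰 → U_F` -/

/-- **THE LEVEL GROUP `{|w| = 1, |w − 1| ≤ r}` IS A SUBGROUP OF `K^×`** (for any `r`): `ww′ − 1 = w(w′−1) + (w−1)`, `w⁻¹ − 1 = −w⁻¹(w−1)`.  (Define-free: existence with its
membership letter, the currency of ★ B1.) [cite: Serre1979, Ch. IV §2 Prop. 6] -/
theorem exists_unitLevel_subgroup (r : ℤᵐ⁰) : ∃ U : Subgroup Kˣ, ∀ w : Kˣ, w ∈ U ↔ Valued.v (w : K) = 1 ∧ Valued.v ((w : K) - 1) ≤ r := by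

  refine ⟨{ carrier := {w | Valued.v (w : K) = 1 ∧ Valued.v ((w : K) - 1) ≤ r}, mul_mem' := ?_, one_mem' := ?_, inv_mem' := ?_ },
    fun w => Iff.rfl⟩
  · rintro a b ⟨ha1, ha2⟩ ⟨hb1, hb2⟩
    refine ⟨by rw [Units.val_mul, map_mul, ha1, hb1, mul_one], ?_⟩
    have e : ((a * b : Kˣ) : K) - 1 = (a : K) * ((b : K) - 1) + ((a : K) - 1) := by push_cast; ring
    rw [e]
    refine (Valuation.map_add _ _ _).trans (max_le ?_ ha2)
    rw [map_mul, ha1, one_mul]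
    exact hb2
  · refine ⟨by rw [Units.val_one, map_one], ?_⟩
    rw [Units.val_one, sub_self, map_zero]
    exact zero_le
  · rintro a ⟨ha1, ha2⟩
    refine ⟨by rw [Units.val_inv_eq_inv_val, map_inv₀, ha1, inv_one], ?_⟩
    have e : ((a⁻¹ : Kˣ) : K) - 1 = -((a : K)⁻¹ * ((a : K) - 1)) := by
      rw [Units.val_inv_eq_inv_val]
      field_simp
      ring
    rw [e, Valuation.map_neg, map_mul, map_inv₀, ha1, inv_one, one_mul]
    exact ha2


/-- **`u ↦ u₁∕u₂` MAPS `𝒰 = (𝒪_F^×)³` ONTO THE FIXED UNITS `U_F = {σw = w, |w| = 1}`** (onto: `u = (1, w, 1)`). [cite: Kottwitz1986BaseChangeUnits, §1 pp. 240–241] -/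
theorem mem_map_fixedUnitTorus_iff (σ : K →+* K) (π : (Fin 3 → Kˣ) →* Kˣ) (hπ : ∀ u, π u = u 1 / u 2) (w : Kˣ) :
    w ∈ (fixedUnitTorus σ 3).map π ↔ σ w = w ∧ Valued.v (w : K) = 1 := by

  rw [Subgroup.mem_map]
  constructor
  · rintro ⟨u, hu, rfl⟩
    obtain ⟨hu1, hu2⟩ := (mem_fixedUnitTorus_iff σ u).1 hu
    rw [hπ, Units.val_div_eq_div_val]
    exact ⟨by rw [map_div₀, hu2, hu2], by rw [map_div₀, hu1, hu1, div_one]⟩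
  · rintro ⟨hσw, hvw⟩
    have h01 : (0 : Fin 3) ≠ 1 := by decide
    have h21 : (2 : Fin 3) ≠ 1 := by decide
    refine ⟨Pi.mulSingle 1 w, (mem_fixedUnitTorus_iff σ _).2 ⟨fun i => ?_, fun i => ?_⟩, ?_⟩
    · by_cases hi : i = 1
      · subst hi; rw [Pi.mulSingle_eq_same]; exact hvw
      · rw [Pi.mulSingle_eq_of_ne hi, Units.val_one, map_one]
    · by_cases hi : i = 1
      · subst hi; rw [Pi.mulSingle_eq_same]; exact hσw
      · rw [Pi.mulSingle_eq_of_ne hi, Units.val_one, map_one]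
    · rw [hπ, Pi.mulSingle_eq_same, Pi.mulSingle_eq_of_ne h21, div_one]

end Summit.HodgeConjecture.HodgeConjecture.Cruxes.H413.F0P3cDyRamDiagonalGluedFixedStabiliser

end
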